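import Summits.RiemannHypothesis.RiemannHypothesis.Theorems.LiPrimeEchoResonantBounds
import Summits.RiemannHypothesis.RiemannHypothesis.Theorems.LiPrimeEchoNonresonantTerms
import Literature.Analysis.Fourier.FresnelConstantValue
import HarnessLib

/-!
# RiemannHypothesis / LiPrimeEcho — crux K2 `LiPrimeEdgeEcho`, part 7: the stationary point; elementary lemmas (RH-FREE)

RH-FREE [rh-li-prover].  Route `Theses/LiPrimeEcho.lean` (rung «Li PRIME-ECHO LAW» `LiTheory.LiZeroWindowEcho`), item
`LiPrimeEdgeEcho` (stmt-RiemannHypothesis-19245).  (1) The resonant phase `P = −y log 2 − n b` has exactly one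
stationary point `s` on the window: `P'(s) = n u(s) − log 2 = 0` with `T₁ + √n/10 < s < T₂ − √n/25` (`c ≥ 5/4`,
`n ≥ 400`; intermediate values, `u` decreasing through `log 2/n` between `1.15√n` and `1.21√n`), and then
`n − 4 ≤ s² log 2 ≤ n`.  (2) At `s` the stationary-phase main term `g(s) conj(𝔣) e^{iP(s)} |P''(s)|^{−1/2}` has real part
`π E₂(n) + O(1)`, `E₂(n) = liPrimeEcho 2 n = A₂ n^{1/4} cos(2√(n log 2) + π/4)`: `e^{n h(s)} = 2(1 + O(1/n))`,
`n(−u₁(s)) = 2(log 2)^{3/2} n^{−1/2}(1 + O(1/n))`, `P(s) = −2√(n log 2) + O(n^{−1/2})`, `𝔣 = √(2π) e^{iπ/4}`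
(`fresnelC_eq`).  Constants are crude (`≤ 400`).  Nothing here bears on the truth of RH.
-/

noncomputable section

-- D-0017: `Summit.<S>.<S>.…` is the designed namespace of a single-problem summit.
set_option linter.dupNamespace false

open Complex MeasureTheory intervalIntegral Set
open scoped Real Interval ArithmeticFunction.vonMangoldt
open Literature.Analysis.Fourier

namespace Summit.RiemannHypothesis.RiemannHypothesis.Theorems.LiTheory

namespace PrimeEdge

/-! ### The stationary point -/

/-- `√n ≥ 20` for `n ≥ 400`, and `(√n)² = n`. -/
theorem sqrt_facts {n : ℕ} (hn : 400 ≤ n) : 20 ≤ Real.sqrt n ∧ Real.sqrt n ^ 2 = n := by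
  have hn' : (400 : ℝ) ≤ n := by exact_mod_cast hn
  refine ⟨?_, Real.sq_sqrt (by positivity)⟩
  have h20 : (20 : ℝ) = Real.sqrt 400 := by
    rw [show (400 : ℝ) = 20 ^ 2 by norm_num, Real.sqrt_sq (by norm_num)]
  rw [h20]
  exact Real.sqrt_le_sqrt hn'

/-- **The stationary point.**  For `c ≥ 5/4`, `n ≥ 400`, `√n ≤ T₁ ≤ √n + 1`, `c√n ≤ T₂`: there is `s` with
`T₁ + √n/10 < s < T₂ − √n/25` and `n u(s) = log 2`. -/
theorem exists_stationary {c : ℝ} (hc : 5 / 4 ≤ c) {n : ℕ} (hn : 400 ≤ n) {T₁ T₂ : ℝ}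
    (h1 : Real.sqrt n ≤ T₁) (h1' : T₁ ≤ Real.sqrt n + 1) (h2 : c * Real.sqrt n ≤ T₂) :
    ∃ s : ℝ, T₁ + Real.sqrt n / 10 < s ∧ s < T₂ - Real.sqrt n / 25 ∧ (n : ℝ) * ua s = Real.log 2 := by
  obtain ⟨hr20, hr2⟩ := sqrt_facts hn
  set r := Real.sqrt n with hr
  have hn' : (400 : ℝ) ≤ n := by exact_mod_cast hn
  have hn0 : (0 : ℝ) < n := by linarith
  set a := T₁ + r / 10 with ha
  set b := T₂ - r / 25 with hb
  have ha_hi : a ≤ 23 / 20 * r := by rw [ha]; linarith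
  have ha_lo : r ≤ a := by rw [ha]; linarith
  have hb_lo : 121 / 100 * r ≤ b := by rw [hb]; nlinarith
  have hab : a < b := by linarith
  have hL := Real.log_two_lt_d9
  have hL' := Real.log_two_gt_d9
  -- `u(a) > log 2/n`
  have hua_a : Real.log 2 / n < ua a := by
    have ha1 : 1 ≤ a := by linarith
    have hlow := ua_ge ha1
    have ha2 : a ^ 2 ≤ 529 / 400 * n := by nlinarith
    have hna : (n : ℝ) ≤ a ^ 2 := by nlinarith
    have ha4 : (n : ℝ) ^ 2 ≤ a ^ 4 := by nlinarith
    have h1a : 400 / (529 * n) ≤ 1 / a ^ 2 := by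
      rw [div_le_div_iff₀ (by positivity) (by positivity)]; nlinarith
    have h4a : 4 / a ^ 4 ≤ 4 / (n : ℝ) ^ 2 := div_le_div_of_nonneg_left (by norm_num) (by positivity) ha4
    have key : Real.log 2 / n < 400 / (529 * n) - 4 / (n : ℝ) ^ 2 := by
      have h4n : (4 : ℝ) / n ≤ 1 / 100 := by rw [div_le_div_iff₀ hn0 (by norm_num)]; linarith
      have e : 400 / (529 * n) - 4 / (n : ℝ) ^ 2 = (400 / 529 - 4 / n) / n := by
        field_simp
      rw [e, div_lt_div_iff_of_pos_right hn0]
      linarith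
    linarith
  -- `u(b) < log 2/n`
  have hua_b : ua b < Real.log 2 / n := by
    have hb0 : 0 < b := by linarith
    have hup := ua_lt hb0
    have hb2 : 14641 / 10000 * n ≤ b ^ 2 := by nlinarith
    have h1b : 1 / b ^ 2 ≤ 10000 / (14641 * n) := by
      rw [div_le_div_iff₀ (by positivity) (by positivity)]; nlinarith
    have key : 10000 / (14641 * n) < Real.log 2 / n := by
      rw [div_lt_div_iff₀ (by positivity) hn0]; nlinarith
    linarith
  obtain ⟨s, hs, hs'⟩ := intermediate_value_Ioo' hab.le continuous_ua.continuousOn ⟨hua_b, hua_a⟩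
  refine ⟨s, hs.1, hs.2, ?_⟩
  rw [hs']
  field_simp

/-- At the stationary point: `n − 4 ≤ s² log 2 ≤ n` (from `1/y² − 4/y⁴ ≤ u < 1/y²`). -/
theorem stationary_sq_bounds {n : ℕ} (hn : 1 ≤ n) {s : ℝ} (hs : Real.sqrt n ≤ s)
    (hstat : (n : ℝ) * ua s = Real.log 2) : s ^ 2 * Real.log 2 ≤ n ∧ (n : ℝ) - 4 ≤ s ^ 2 * Real.log 2 := by
  obtain ⟨hs1, hsn, -⟩ := window_facts hn hs
  have hs0 : 0 < s := by linarith
  have hn0 : (0 : ℝ) < n := by exact_mod_cast hn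
  constructor
  · have h : Real.log 2 < n * (1 / s ^ 2) := by rw [← hstat]; exact mul_lt_mul_of_pos_left (ua_lt hs0) hn0
    rw [mul_one_div, lt_div_iff₀ (by positivity)] at h
    linarith
  · have h : (n : ℝ) * (1 / s ^ 2 - 4 / s ^ 4) ≤ Real.log 2 := by
      rw [← hstat]; exact mul_le_mul_of_nonneg_left (ua_ge hs1) hn0.le
    have e : (n : ℝ) * (1 / s ^ 2 - 4 / s ^ 4) * s ^ 2 = n - 4 * (n / s ^ 2) := by
      field_simp
    have h4 : (n : ℝ) / s ^ 2 ≤ 1 := by rw [div_le_one (by positivity)]; exact hsn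
    have := mul_le_mul_of_nonneg_right h (sq_nonneg s)
    rw [e] at this
    nlinarith

/-! ### The main term -/

/-- `conj(𝔣) e^{iP} = √(2π) e^{i(P − π/4)}`. -/
theorem conj_fresnelC_mul_exp (P : ℝ) :
    (starRingEnd ℂ) fresnelC * Complex.exp (I * P) =
      (Real.sqrt (2 * Real.pi) : ℂ) * Complex.exp (I * ((P - Real.pi / 4 : ℝ) : ℂ)) := by
  rw [fresnelC_eq, map_mul, Complex.conj_ofReal, ← Complex.exp_conj, map_mul, Complex.conj_ofReal, Complex.conj_I,
    mul_assoc, ← Complex.exp_add]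
  congr 2
  push_cast
  ring

/-- Real part of `X e^{iθ}`. -/
theorem re_ofReal_mul_exp (X θ : ℝ) : ((X : ℂ) * Complex.exp (I * (θ : ℂ))).re = X * Real.cos θ := by
  rw [Complex.re_ofReal_mul, mul_comm I, Complex.exp_ofReal_mul_I_re]

/-- Elementary: for `0 < ν ≤ 1/400` and reals `e, W` with `|e − 1| ≤ 56ν`, `1 − 30ν ≤ W ≤ 1 + 52ν`:
`1 − 108ν ≤ e/W ≤ 1 + 100ν`. -/
theorem ratio_bounds {ν e W : ℝ} (hν0 : 0 < ν) (hν : ν ≤ 1 / 400) (he : |e - 1| ≤ 56 * ν) (hW1 : 1 - 30 * ν ≤ W)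
    (hW2 : W ≤ 1 + 52 * ν) : 1 - 108 * ν ≤ e / W ∧ e / W ≤ 1 + 100 * ν := by
  have hW0 : 0 < W := by linarith only [hW1, hν]
  have hν2 : 0 ≤ ν ^ 2 := sq_nonneg ν
  have hν3 : 3000 * ν ^ 2 ≤ 14 * ν := by nlinarith only [hν0, hν]
  obtain ⟨he1, he2⟩ := abs_le.1 he
  constructor
  · rw [le_div_iff₀ hW0]
    have h1 : (1 - 108 * ν) * W ≤ (1 - 108 * ν) * (1 + 52 * ν) :=
      mul_le_mul_of_nonneg_left hW2 (by linarith only [hν])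
    have e1 : (1 - 108 * ν) * (1 + 52 * ν) = 1 - 56 * ν - 5616 * ν ^ 2 := by ring
    linarith only [h1, e1, he1, hν2]
  · rw [div_le_iff₀ hW0]
    have h1 : (1 + 100 * ν) * (1 - 30 * ν) ≤ (1 + 100 * ν) * W := mul_le_mul_of_nonneg_left hW1 (by positivity)
    have e1 : (1 + 100 * ν) * (1 - 30 * ν) = 1 + 70 * ν - 3000 * ν ^ 2 := by ring
    linarith only [h1, e1, he2, hν3]

/-- `(1 + 15ν)²(1 + 5ν)³ ≤ 1 + 52ν` and `1 − 30ν ≤ (1 − 15ν)²` for `0 < ν ≤ 1/400`. -/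
theorem poly_bounds {ν : ℝ} (hν0 : 0 < ν) (hν : ν ≤ 1 / 400) :
    (1 + 15 * ν) ^ 2 * (1 + 5 * ν) ^ 3 ≤ 1 + 52 * ν ∧ 1 - 30 * ν ≤ (1 - 15 * ν) ^ 2 := by
  have hν2 : ν ^ 2 ≤ ν / 400 := by nlinarith only [hν0, hν]
  have hν20 : 0 ≤ ν ^ 2 := sq_nonneg ν
  have hν3 : ν ^ 3 ≤ ν / 160000 := by nlinarith only [hν0, hν, hν2]
  constructor
  · have e2 : (1 + 15 * ν) ^ 2 = 1 + 30 * ν + 225 * ν ^ 2 := by ring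
    have e3 : (1 + 5 * ν) ^ 3 = 1 + 15 * ν + 75 * ν ^ 2 + 125 * ν ^ 3 := by ring
    have h2 : (1 + 15 * ν) ^ 2 ≤ 1 + 31 * ν := by linarith only [e2, hν2, hν0]
    have h3 : (1 + 5 * ν) ^ 3 ≤ 1 + 16 * ν := by linarith only [e3, hν2, hν3, hν0]
    have h4 : (1 + 15 * ν) ^ 2 * (1 + 5 * ν) ^ 3 ≤ (1 + 31 * ν) * (1 + 16 * ν) :=
      mul_le_mul h2 h3 (by positivity) (by positivity)
    have e4 : (1 + 31 * ν) * (1 + 16 * ν) = 1 + 47 * ν + 496 * ν ^ 2 := by ring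
    linarith only [h4, e4, hν2, hν0]
  · nlinarith only [hν20]

/-- `κ⁴ = (log 2)⁴/64`. -/
theorem kap_pow_four : kap ^ 4 = Real.log 2 ^ 4 / 64 := by
  rw [kap, mul_pow]
  have : ((2 : ℝ) ^ (-(3 / 2 : ℝ))) ^ 4 = 1 / 64 := by
    rw [← Real.rpow_natCast, ← Real.rpow_mul (by norm_num)]
    rw [show (-(3 / 2 : ℝ)) * ((4 : ℕ) : ℝ) = ((-6 : ℤ) : ℝ) by norm_num, Real.rpow_intCast]
    norm_num
  rw [this]; ring

/-- `κ ≤ 1/4` (so `κe ≤ 3/4 ≤ 1`). -/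
theorem kap_le : kap ≤ 1 / 4 := by
  have h4 : kap ^ 4 ≤ (1 / 4 : ℝ) ^ 4 := by
    rw [kap_pow_four]
    have hL := Real.log_two_lt_d9
    have hL0 : 0 < Real.log 2 := Real.log_pos (by norm_num)
    have : Real.log 2 ^ 4 ≤ (7 / 10 : ℝ) ^ 4 := pow_le_pow_left₀ hL0.le (by linarith) 4
    nlinarith only [this]
  exact (pow_le_pow_iff_left₀ kap_pos.le (by norm_num) (by norm_num)).1 h4

/-- `κ e ≤ 1`. -/
theorem kap_mul_exp_le : kap * Real.exp 1 ≤ 1 := by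
  have h1 := kap_le
  have h2 := Real.exp_one_lt_d9
  nlinarith [kap_pos, Real.exp_pos 1]

end PrimeEdge

end Summit.RiemannHypothesis.RiemannHypothesis.Theorems.LiTheory
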